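import Summits.AtomisticToContinuum.HydrodynamicLimit.Theses.BoxDissipativeWeakStrong
import Literature.MathematicalPhysics.KineticTheory.HardSphereEulerProofs
import Literature.Analysis.FluidPDE.CollisionalTransfer
import Literature.Analysis.FunctionSpaces.TorusCalculusProofs
import Summits.AtomisticToContinuum.HydrodynamicLimit.Theorems.BoxDissipativeWeakStrongLocalGibbsFineScaleKernels
import HarnessLib

/-!
# Crux `FluxClosure` (stmt-AtomisticToContinuum-9902), line `birth` — stub B3:
# fixed-configuration box bookkeeping (`stub_boxStreamingSplit`)

Support file (`--supports stmt-AtomisticToContinuum-9902`) proving the stub `stub_boxStreamingSplit`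
of the lead's skeleton of
`Summit.AtomisticToContinuum.HydrodynamicLimit.Theses.BoxDissipativeWeakStrong.FluxClosure`.

For ONE configuration `z'` of `N+1` hard spheres on `𝕋³`, the cube kernel
`K_ℓ(x, y) = ℓ⁻³ 𝟙[∀ i, ‖yᵢ - xᵢ‖ < ℓ/2]`, a time `t ∈ [0,T)` and a test field `w` smooth on the
slab `[0,T) × 𝕋³`, with the box fields `ρ̂(x) = (N+1)⁻¹ Σₐ K_ℓ(x,qₐ)`,
`m̂(x) = (N+1)⁻¹ Σₐ K_ℓ(x,qₐ) vₐ`, `Ê`, `S_kin(x) = (N+1)⁻¹ Σₐ K_ℓ(x,qₐ) vₐ ⊗ vₐ`: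

* (a) `∫ ⟪m̂(x), w(t,x)⟫ dx = (N+1)⁻¹ Σₐ ⟪∫ K_ℓ(x,qₐ) w(t,x) dx, vₐ⟫` (Fubini for the finite
  empirical sum);
* (b) the particle-level streaming term
  `(N+1)⁻¹ Σₐ [⟪∫ K_ℓ(·,qₐ) ∂ₜw, vₐ⟫ + Σⱼₖ vₐⱼ vₐₖ ∫ K_ℓ(·,qₐ) ∂ₖwⱼ]` equals `Q - R + S`, the crux's
  three frozen-time box functionals (`Q = ∫ ⟪m̂,∂ₜw⟫ + (m̂⊗m̂/ρ̂):∇w + p_cut div w`,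
  `R = ∫ ρ̂θ̂(Z_cut - 1) div w`, `S = ∫ (S_kin - m̂⊗m̂/ρ̂ - ρ̂θ̂𝟙):∇w`): by Fubini the left side is
  `∫ ⟪m̂,∂ₜw⟫ + Σᵢⱼ ∫ S_kin,ij ∂ⱼwᵢ`, and `Q - R + S` collapses to the same by linearity of `∫ dx`
  and `p_cut = ρ̂θ̂Z_cut`, `div w = Σᵢ ∂ᵢwᵢ`.

The only analytic content is the `x`-integrability of every integrand. We organise it through
ONE device (`integrable_comp_finiteRange`): the occupation pattern
`x ↦ (K_ℓ(x, qₐ))ₐ ∈ {0, ℓ⁻³}^{N+1}` is measurable with FINITE range, so any expression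
`Φ(pattern(x), x)` with `Φ(p, ·)` continuous on the compact torus for each pattern `p` is a finite
sum of indicators of measurable level sets times continuous functions, hence integrable — this
covers the quotients `m̂ᵢm̂ⱼ/ρ̂`, the box temperature and the cut compressibility `Z_cut(ρ̂σ³)`
without any explicit bound. The test-field slices `w(t,·)`, `∂ₜw(t,·)` (one-sided in time,
`Torus.IsSmoothSpaceTimeOn.isSmooth_timeDerivWithin` on the slab `Ico 0 T`), `∂ⱼwᵢ(t,·)` are smooth,
hence continuous. The identities are then proved for an abstract measurable finite-range pattern
(`integral_inner_pattern_smul_sum`, `streaming_fubini`, `box_cancellation`) and specialised.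

No definitions. References: H. Spohn, *Large Scale Dynamics of Interacting Particles* (1991),
Part I §3.2–3.3 ((3.3)–(3.8)); R. Soto, *Kinetic Theory and Transport Phenomena* (2016) §4.8.1.
-/

noncomputable section

namespace Summit.AtomisticToContinuum.HydrodynamicLimit.Theorems
namespace FluxClosureB3

open scoped BigOperators Topology Classical MeasureTheory ProbabilityTheory InnerProductSpace
open scoped ENNReal
open Filter Set Function MeasureTheory
open Literature.MathematicalPhysics.KineticTheory Literature.Analysis.FluidPDE
open Literature.Analysis.FunctionSpaces

/-! ### Integrability through a finite-range measurable pattern -/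

/-- **Finite-range device.** If `P : 𝕋³ → β` is measurable with finite range and `Φ p` is
continuous on the torus for every `p`, then `x ↦ Φ (P x) x` is integrable: it is the finite sum
over the range of `𝟙[P = p] Φ p`. [folklore] -/
theorem integrable_comp_finiteRange {β F : Type*} [MeasurableSpace β] [MeasurableSingletonClass β]
    [NormedAddCommGroup F] {P : T3 → β} (hP : Measurable P) (hfin : (Set.range P).Finite)
    (Φ : β → T3 → F) (hΦ : ∀ p, Continuous (Φ p)) :
    Integrable (fun x => Φ (P x) x) := by
  have heq : (fun x => Φ (P x) x) =
      fun x => ∑ p ∈ hfin.toFinset, (P ⁻¹' {p}).indicator (Φ p) x := by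
    funext x
    rw [Finset.sum_eq_single_of_mem (P x) (hfin.mem_toFinset.2 (Set.mem_range_self x))]
    · rw [Set.indicator_of_mem (show x ∈ P ⁻¹' {P x} from rfl)]
    · intro p _ hp
      exact Set.indicator_of_notMem (fun h : x ∈ P ⁻¹' {p} => hp (Set.mem_singleton_iff.1 h).symm) _
  rw [heq]
  exact integrable_finsetSum _ fun p _ =>
    ((hΦ p).integrable_unitAddTorus).indicator (hP (measurableSet_singleton p))

/-! ### The cube kernel read at the particles, as a function of the box centre -/

/-- The cube kernel is symmetric: `K_ℓ(x, y) = K_ℓ(y, x)`. [folklore] -/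
theorem boxK_symm (l : ℝ) (x y : T3) :
    Set.indicator {y' : T3 | ∀ i, ‖y' i - x i‖ < l / 2} (fun _ => (l ^ 3)⁻¹) y =
      Set.indicator {y' : T3 | ∀ i, ‖y' i - y i‖ < l / 2} (fun _ => (l ^ 3)⁻¹) x := by
  have h : (∀ i, ‖y i - x i‖ < l / 2) ↔ ∀ i, ‖x i - y i‖ < l / 2 :=
    forall_congr' fun i => by rw [norm_sub_rev]
  by_cases hy : ∀ i, ‖y i - x i‖ < l / 2
  · rw [Set.indicator_of_mem (show y ∈ {y' : T3 | ∀ i, ‖y' i - x i‖ < l / 2} from hy),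
      Set.indicator_of_mem (show x ∈ {y' : T3 | ∀ i, ‖y' i - y i‖ < l / 2} from h.1 hy)]
  · rw [Set.indicator_of_notMem (show y ∉ {y' : T3 | ∀ i, ‖y' i - x i‖ < l / 2} from hy),
      Set.indicator_of_notMem (show x ∉ {y' : T3 | ∀ i, ‖y' i - y i‖ < l / 2} from
        fun hx => hy (h.2 hx))]

/-- The cube kernel takes only the values `0` and `ℓ⁻³`. [folklore] -/
theorem boxK_mem_pair (l : ℝ) (x y : T3) :
    Set.indicator {y' : T3 | ∀ i, ‖y' i - x i‖ < l / 2} (fun _ => (l ^ 3)⁻¹) y ∈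
      ({0, (l ^ 3)⁻¹} : Set ℝ) := by
  by_cases hy : y ∈ {y' : T3 | ∀ i, ‖y' i - x i‖ < l / 2}
  · rw [Set.indicator_of_mem hy]; simp
  · rw [Set.indicator_of_notMem hy]; simp

/-- **The occupation pattern is measurable**: for a configuration `z'`, the vector of kernel
weights `x ↦ (K_ℓ(x, qₐ))ₐ` is a measurable map `𝕋³ → ℝ^{n}`. [folklore] -/
theorem measurable_boxK_pattern {n : ℕ} (l : ℝ) (z' : Config n (Fin 3) T3) :
    Measurable fun (x : T3) (a : Fin n) =>
      Set.indicator {y' : T3 | ∀ i, ‖y' i - x i‖ < l / 2} (fun _ => (l ^ 3)⁻¹) (z' a).1 := by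
  refine measurable_pi_lambda _ fun a => ?_
  simp_rw [boxK_symm l _ (z' a).1]
  exact LGFS.measurable_boxK_right l (z' a).1

/-- **The occupation pattern has finite range** (`⊂ {0, ℓ⁻³}^n`). [folklore] -/
theorem finite_range_boxK_pattern {n : ℕ} (l : ℝ) (z' : Config n (Fin 3) T3) :
    (Set.range fun (x : T3) (a : Fin n) =>
      Set.indicator {y' : T3 | ∀ i, ‖y' i - x i‖ < l / 2} (fun _ => (l ^ 3)⁻¹)
        (z' a).1).Finite := by
  refine (Set.Finite.pi' fun _ : Fin n => Set.toFinite ({0, (l ^ 3)⁻¹} : Set ℝ)).subset ?_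
  rintro _ ⟨x, rfl⟩
  exact fun a => boxK_mem_pair l x (z' a).1

/-! ### The identities for an abstract finite-range pattern -/

variable {n : ℕ} {k : T3 → Fin n → ℝ}

/-- **Fubini for the box momentum pairing**: for a measurable finite-range pattern `k`, velocities
`vₐ`, a scalar `c` and a continuous field `B`,
`∫ ⟪c Σₐ k(x)ₐ vₐ, B x⟫ dx = c Σₐ ⟪∫ k(x)ₐ B x dx, vₐ⟫`. [folklore] -/
theorem integral_inner_pattern_smul_sum (hk : Measurable k) (hfin : (Set.range k).Finite)
    (v : Fin n → V3) (c : ℝ) {B : T3 → V3} (hB : Continuous B) :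
    (∫ x, ⟪c • ∑ a, k x a • v a, B x⟫_ℝ) = c * ∑ a, ⟪∫ x, k x a • B x, v a⟫_ℝ := by
  have hI : ∀ a, Integrable (fun x => k x a • B x) := fun a =>
    integrable_comp_finiteRange hk hfin (fun p x => p a • B x) fun p => by fun_prop
  have hpt : ∀ x, ⟪c • ∑ a, k x a • v a, B x⟫_ℝ = c * ∑ a, ⟪v a, k x a • B x⟫_ℝ := by
    intro x
    simp only [real_inner_smul_left, sum_inner, real_inner_smul_right]
  simp_rw [hpt]
  rw [integral_const_mul, integral_finsetSum _ fun a _ => (hI a).const_inner _]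
  congr 1
  refine Finset.sum_congr rfl fun a _ => ?_
  rw [integral_inner (hI a), real_inner_comm]

/-- **Fubini for the particle-level streaming term**: with `m̂ = c Σₐ kₐ vₐ` and
`S_kin = c Σₐ kₐ vₐ ⊗ vₐ`,
`c Σₐ [⟪∫ kₐ A, vₐ⟫ + Σᵢⱼ vₐᵢ vₐⱼ ∫ kₐ ∂ⱼwᵢ] = ∫ ⟪m̂, A⟫ + ∫ Σᵢⱼ S_kin,ij ∂ⱼwᵢ`
(`D i j = ∂ᵢwⱼ`, `A = ∂ₜw`, both continuous). [folklore] -/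
theorem streaming_fubini (hk : Measurable k) (hfin : (Set.range k).Finite) (v : Fin n → V3)
    (c : ℝ) {A : T3 → V3} (hA : Continuous A) {D : Fin 3 → Fin 3 → T3 → ℝ}
    (hD : ∀ i j, Continuous (D i j)) :
    c * ∑ a, (⟪∫ x, k x a • A x, v a⟫_ℝ + ∑ i, ∑ j, v a i * v a j * ∫ x, k x a * D j i x) =
      (∫ x, ⟪c • ∑ a, k x a • v a, A x⟫_ℝ) +
        ∫ x, ∑ i, ∑ j, (c * ∑ a, k x a * (v a i * v a j)) * D j i x := by
  have hKD : ∀ a i j, Integrable (fun x => k x a * D j i x) := fun a i j =>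
    integrable_comp_finiteRange hk hfin (fun p x => p a * D j i x) fun p => by fun_prop
  rw [Finset.sum_add_distrib, mul_add, integral_inner_pattern_smul_sum hk hfin v c hA]
  congr 1
  have hpt : ∀ x, (∑ i, ∑ j, (c * ∑ a, k x a * (v a i * v a j)) * D j i x) =
      ∑ i, ∑ j, ∑ a, c * (v a i * v a j) * (k x a * D j i x) := fun x => by
    refine Finset.sum_congr rfl fun i _ => Finset.sum_congr rfl fun j _ => ?_
    rw [Finset.mul_sum, Finset.sum_mul]
    exact Finset.sum_congr rfl fun a _ => by ring
  simp_rw [hpt]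
  calc c * ∑ a, ∑ i, ∑ j, v a i * v a j * ∫ x, k x a * D j i x
      = ∑ i, ∑ j, ∑ a, c * (v a i * v a j) * ∫ x, k x a * D j i x := by
        simp_rw [Finset.mul_sum]
        rw [Finset.sum_comm]
        refine Finset.sum_congr rfl fun i _ => ?_
        rw [Finset.sum_comm]
        exact Finset.sum_congr rfl fun j _ => Finset.sum_congr rfl fun a _ => by ring
    _ = ∫ x, ∑ i, ∑ j, ∑ a, c * (v a i * v a j) * (k x a * D j i x) := by
        rw [integral_finsetSum _ fun i _ => integrable_finsetSum _ fun j _ =>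
          integrable_finsetSum _ fun a _ => (hKD a i j).const_mul _]
        refine Finset.sum_congr rfl fun i _ => ?_
        rw [integral_finsetSum _ fun j _ =>
          integrable_finsetSum _ fun a _ => (hKD a i j).const_mul _]
        refine Finset.sum_congr rfl fun j _ => ?_
        rw [integral_finsetSum _ fun a _ => (hKD a i j).const_mul _]
        refine Finset.sum_congr rfl fun a _ => ?_
        rw [integral_const_mul]

/-- The pointwise cancellation behind `Q - R + S`: with `X = Σᵢⱼ Mᵢⱼ Dⱼᵢ`, `W = Σᵢ Dᵢᵢ`,
`(a + X + rθZW) - rθ(Z-1)W + Σᵢⱼ (Sᵢⱼ - Mᵢⱼ - δᵢⱼ rθ) Dⱼᵢ = a + Σᵢⱼ Sᵢⱼ Dⱼᵢ`. [folklore] -/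
theorem pointwise_cancellation (a r θ Z : ℝ) (M S Dx : Fin 3 → Fin 3 → ℝ) :
    (a + (∑ i, ∑ j, M i j * Dx j i) + r * θ * Z * ∑ i, Dx i i) -
        (r * θ * (Z - 1) * ∑ i, Dx i i) +
      ∑ i, ∑ j, (S i j - M i j - (if i = j then r * θ else 0)) * Dx j i =
    a + ∑ i, ∑ j, S i j * Dx j i := by
  simp only [sub_mul, Finset.sum_sub_distrib, ite_mul, zero_mul, Finset.sum_ite_eq,
    Finset.mem_univ, if_true]
  rw [← Finset.mul_sum]
  ring

/-- `∫ f - ∫ g + ∫ h = ∫ (f - g + h)` for integrable `f, g, h`. [folklore] -/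
theorem integral_sub_add_eq {f g h : T3 → ℝ} (hf : Integrable f) (hg : Integrable g)
    (hh : Integrable h) :
    (∫ x, f x) - (∫ x, g x) + (∫ x, h x) = ∫ x, (f x - g x + h x) := by
  have hfg : Integrable (fun x => f x - g x) := hf.sub hg
  rw [integral_add hfg hh, integral_sub hf hg]

/-- **Linearity of `∫ dx` (the `Q - R + S` collapse)** for an abstract measurable finite-range
pattern `k` and ARBITRARY readings `ρ, m, E, S, Z` of the pattern and `Th` of `(ρ, m, E)`: every
integrand is integrable by `integrable_comp_finiteRange`, and pointwise the three integrands
collapse (`pointwise_cancellation`). [folklore] -/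
theorem box_cancellation (hk : Measurable k) (hfin : (Set.range k).Finite)
    (ρ E Z : (Fin n → ℝ) → ℝ) (m : (Fin n → ℝ) → V3) (S : (Fin n → ℝ) → Fin 3 → Fin 3 → ℝ)
    (Th : ℝ → V3 → ℝ → ℝ) {A : T3 → V3} (hA : Continuous A)
    {D : Fin 3 → Fin 3 → T3 → ℝ} (hD : ∀ i j, Continuous (D i j)) :
    (∫ x, (⟪m (k x), A x⟫_ℝ + (∑ i, ∑ j, m (k x) i * m (k x) j / ρ (k x) * D j i x) +
        ρ (k x) * Th (ρ (k x)) (m (k x)) (E (k x)) * Z (k x) * ∑ i, D i i x)) -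
      (∫ x, ρ (k x) * Th (ρ (k x)) (m (k x)) (E (k x)) * (Z (k x) - 1) * ∑ i, D i i x) +
      ∫ x, ∑ i, ∑ j, (S (k x) i j - m (k x) i * m (k x) j / ρ (k x) -
        (if i = j then ρ (k x) * Th (ρ (k x)) (m (k x)) (E (k x)) else 0)) * D j i x =
    (∫ x, ⟪m (k x), A x⟫_ℝ) + ∫ x, ∑ i, ∑ j, S (k x) i j * D j i x := by
  have hQ : Integrable (fun x => ⟪m (k x), A x⟫_ℝ +
      (∑ i, ∑ j, m (k x) i * m (k x) j / ρ (k x) * D j i x) +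
        ρ (k x) * Th (ρ (k x)) (m (k x)) (E (k x)) * Z (k x) * ∑ i, D i i x) :=
    integrable_comp_finiteRange hk hfin (fun p x => ⟪m p, A x⟫_ℝ +
      (∑ i, ∑ j, m p i * m p j / ρ p * D j i x) + ρ p * Th (ρ p) (m p) (E p) * Z p * ∑ i, D i i x)
      fun p => by fun_prop
  have hR : Integrable (fun x =>
      ρ (k x) * Th (ρ (k x)) (m (k x)) (E (k x)) * (Z (k x) - 1) * ∑ i, D i i x) :=
    integrable_comp_finiteRange hk hfin
      (fun p x => ρ p * Th (ρ p) (m p) (E p) * (Z p - 1) * ∑ i, D i i x) fun p => by fun_prop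
  have hS : Integrable (fun x => ∑ i, ∑ j, (S (k x) i j - m (k x) i * m (k x) j / ρ (k x) -
      (if i = j then ρ (k x) * Th (ρ (k x)) (m (k x)) (E (k x)) else 0)) * D j i x) :=
    integrable_comp_finiteRange hk hfin (fun p x => ∑ i, ∑ j, (S p i j - m p i * m p j / ρ p -
      (if i = j then ρ p * Th (ρ p) (m p) (E p) else 0)) * D j i x) fun p => by fun_prop
  have hM : Integrable (fun x => ⟪m (k x), A x⟫_ℝ) :=
    integrable_comp_finiteRange hk hfin (fun p x => ⟪m p, A x⟫_ℝ) fun p => by fun_prop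
  have hSD : Integrable (fun x => ∑ i, ∑ j, S (k x) i j * D j i x) :=
    integrable_comp_finiteRange hk hfin (fun p x => ∑ i, ∑ j, S p i j * D j i x)
      fun p => by fun_prop
  rw [integral_sub_add_eq hQ hR hS, ← integral_add hM hSD]
  refine integral_congr_ae (ae_of_all _ fun x => ?_)
  exact pointwise_cancellation _ _ _ _ (fun i j => m (k x) i * m (k x) j / ρ (k x)) (S (k x))
    (fun i j => D i j x)

/-! ### The stub -/

/-- **Stub B3 of crux `FluxClosure` (route `BoxDissipativeWeakStrong`, line `birth`): fixed-
configuration box bookkeeping.** For one configuration `z'` of `N+1` particles, the cube kernel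
`K_ℓ` (`0 < ℓ ≤ 1`), `t ∈ [0,T)` and `w` smooth on `[0,T) × 𝕋³`:
(a) `∫ ⟪m̂(x), w(t,x)⟫ dx = (N+1)⁻¹ · momentumObservable (K_ℓ ⋆ w(t)) z'`;
(b) the particle-level streaming term
`(N+1)⁻¹ Σₐ [⟪∫ K_ℓ(·,qₐ) ∂ₜw, vₐ⟫ + Σⱼₖ vₐⱼvₐₖ ∫ K_ℓ(·,qₐ) ∂ₖwⱼ]` equals `Q - R + S`, the
crux's three box functionals at the frozen configuration. Proof: the box
fields are readings of the measurable finite-range occupation pattern `x ↦ (K_ℓ(x,qₐ))ₐ`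
(`empirical*Field_eq_sum`, `integral_empiricalMeasure`), the slices `w(t,·)`, `∂ₜw(t,·)`,
`∂ⱼwᵢ(t,·)` are continuous, and the abstract identities `integral_inner_pattern_smul_sum`,
`streaming_fubini`, `box_cancellation` apply verbatim. -/
theorem stub_boxStreamingSplit : ∀ (σ η₁ T l : ℝ), 0 < l → l ≤ 1 → ∀ w : ℝ → T3 → V3, Torus.IsSmoothSpaceTimeOn (Ico 0 T) w → ∀ (N : ℕ) (z' : Config (N + 1) (Fin 3) T3), ∀ t ∈ Ico 0 T, let K := fun (l : ℝ) (x y : T3) => indicator {y' : T3 | ∀ i, ‖y' i - x i‖ < l / 2} (fun _ => (l ^ 3)⁻¹) y; let Dn := fun x => empiricalDensityField z' (K l x); let Mm := fun x => empiricalMomentumField z' (K l x); let En := fun x => empiricalEnergyField z' (K l x); let Sk := fun x (i j : Fin 3) => ∫ y, K l x y.1 * (y.2 i * y.2 j) ∂(empiricalMeasure z'); let Th := fun (r : ℝ) (m : V3) (E : ℝ) => 2 / 3 * (E / r - ‖m‖ ^ 2 / (2 * r ^ 2)); let Zc := fun η : ℝ => hsCompressibility (min η η₁); let Pc := fun r ϑ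 : ℝ => r * ϑ * Zc (r * σ ^ 3); (∫ x, inner ℝ (Mm x) (w t x)) = ((N : ℝ) + 1)⁻¹ * momentumObservable (fun q => ∫ x, K l x q • w t x) z' ∧ ((N : ℝ) + 1)⁻¹ * ∑ i, (inner ℝ (∫ x, K l x (z' i).1 • Torus.timeDerivWithin (Ico 0 T) w t x) (z' i).2 + ∑ j, ∑ k, (z' i).2 j * (z' i).2 k * ∫ x, K l x (z' i).1 * Torus.partialDeriv k (fun y => w t y j) x) = (∫ x, (inner ℝ (Mm x) (Torus.timeDerivWithin (Ico 0 T) w t x) + (∑ i, ∑ j, Mm x i * Mm x j / Dn x * Torus.partialDeriv j (fun y => w t y i) x) + Pc (Dn x) (Th (Dn x) (Mm x) (En x)) * Torus.divergence (w t) x)) - (∫ x, Dn x * Th (Dn x) (Mm x) (En x) * (Zc (Dn x * σ ^ 3) - 1) * Torus.divergence (w t) x) + ∫ x, ∑ i, ∑ j, (Sk x i j - Mm x i * Mm x j / Dn x - (if i = j then Dn x * Th (Dn x) (Mm x) (En x) else 0)) * Torus.partialDeriv j (fun y => w t y i) x := by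
  intro σ η₁ T l _hl _hl1 w hw N z' t ht K Dn Mm En Sk Th Zc Pc
  -- continuity of the test-field slices at time `t ∈ [0,T)`
  have hwt : Torus.IsSmooth (w t) := hw.isSmooth_slice ht
  have hA : Continuous (Torus.timeDerivWithin (Ico 0 T) w t) :=
    (hw.isSmooth_timeDerivWithin (uniqueDiffOn_Ico 0 T) ht).continuous
  have hD : ∀ i j : Fin 3, Continuous (fun x => Torus.partialDeriv i (fun y => w t y j) x) :=
    fun i j => ((hwt.apply j).partialDeriv i).continuous
  -- the occupation pattern `x ↦ (K_ℓ(x, qₐ))ₐ` is measurable with finite range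
  have hk : Measurable fun (x : T3) (a : Fin (N + 1)) => K l x (z' a).1 :=
    measurable_boxK_pattern l z'
  have hfin : (Set.range fun (x : T3) (a : Fin (N + 1)) => K l x (z' a).1).Finite :=
    finite_range_boxK_pattern l z'
  -- the box fields are readings of the pattern
  have hDn : ∀ x, Dn x = ((N : ℝ) + 1)⁻¹ * ∑ a, K l x (z' a).1 := fun x => by
    simp only [Dn, empiricalDensityField_eq_sum, Nat.cast_add, Nat.cast_one]
  have hMm : ∀ x, Mm x = ((N : ℝ) + 1)⁻¹ • ∑ a, K l x (z' a).1 • (z' a).2 := fun x => by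
    simp only [Mm, empiricalMomentumField_eq_sum, Nat.cast_add, Nat.cast_one]
  have hEn : ∀ x, En x = ((N : ℝ) + 1)⁻¹ * ∑ a, K l x (z' a).1 * (‖(z' a).2‖ ^ 2 / 2) :=
    fun x => by
    simp only [En, empiricalEnergyField_eq_sum, Nat.cast_add, Nat.cast_one]
  have hSk : ∀ x i j, Sk x i j =
      ((N : ℝ) + 1)⁻¹ * ∑ a, K l x (z' a).1 * ((z' a).2 i * (z' a).2 j) := fun x i j => by
    simp only [Sk, integral_empiricalMeasure, Nat.cast_add, Nat.cast_one]
  simp only [hDn, hMm, hEn, hSk]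
  refine ⟨integral_inner_pattern_smul_sum hk hfin (fun a => (z' a).2) (((N : ℝ) + 1)⁻¹)
    hwt.continuous, ?_⟩
  exact (streaming_fubini hk hfin (fun a => (z' a).2) (((N : ℝ) + 1)⁻¹) hA hD).trans
    (box_cancellation hk hfin (fun p => ((N : ℝ) + 1)⁻¹ * ∑ a, p a)
      (fun p => ((N : ℝ) + 1)⁻¹ * ∑ a, p a * (‖(z' a).2‖ ^ 2 / 2))
      (fun p => Zc (((N : ℝ) + 1)⁻¹ * (∑ a, p a) * σ ^ 3))
      (fun p => ((N : ℝ) + 1)⁻¹ • ∑ a, p a • (z' a).2)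
      (fun p i j => ((N : ℝ) + 1)⁻¹ * ∑ a, p a * ((z' a).2 i * (z' a).2 j)) Th hA hD).symm

end FluxClosureB3
end Summit.AtomisticToContinuum.HydrodynamicLimit.Theorems
end
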